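import Summits.HubbardSuperconductivity.HubbardSuperconductivity.Theorems.AnisotropyChordSpinMonotoneTPosDefs
import Mathlib.Analysis.SpecialFunctions.Exp

/-!
# Route `AnisotropyChord`: REAL STABILITY of XXZ sector ground states — the theory seat's cycle-6
# negative-dependence layer (A-STAB, B-STAB, T-INT) TYPED, with the gate algebra proved
# (definitions; bears on `FerroSideChord` stmt-19089 via the `U_vt` / TM-VT ladder; PORT-SPEC P-6, typed part)

Typing authority: THEORY seat `hubbard-h0-rotor-theory-1`, cycle 6, memo ROTOR-THEORY-6 §63–§66 and
`Sketch6.lean` §RealStability (transplanted verbatim up to docstring tags), over the tree's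
`xxzHamiltonian 1 G (−1) Δ` and `IsSectorGroundState` (`…SpinMonotoneTPosDefs`).

* `ampPoly ψ z = Σ_σ ψ(σ) Π_{σ x = 1} z_x` — the amplitude polynomial (multi-affine generating
  function) of a spin-½ state; `IsStable p` — no zero with all `Im z_x > 0`;
  `InProperPositionUpToPhase p q` — phase-free proper position (all real combinations stable or zero).
* **A-STAB** `XXZGroundStateAmplitudeStable` (THEOREM on paper, every finite connected graph,
  `Δ ∈ [−1,1]`: sector ground states have STABLE amplitude polynomials = strong Rayleigh amplitude law;
  proof via the Borcea–Brändén symbol of the two-site gate, Trotter, Hurwitz, Perron–Frobenius — the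
  Borcea–Brändén / COSW facts are not yet in `Literature/`, so it is recorded here as a typed statement);
  **B-STAB** `XXZGroundStateBornStable` (conjecture, window `[0,1]`); **T-INT** `XXZTowerProperPosition`
  (adjacent-sector ground states in proper position; paper proof via Borcea–Brändén Thm 1.6).
* PROVED: `isStable_smul_iff`; the gate algebra `gate_signature` (the gate's `ℤ₂×ℤ₂` eigenvalue signs:
  `A ≤ B+C ↔ Δ ≤ 1`, `B−C ≤ A ↔ −1 ≤ Δ`), `gate_preserves_real_bilinear_cone` (the constant-coefficient
  shadow of the preserver statement: the real bilinear stable cone `ad ≤ bc` is mapped into itself iff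
  `B − C ≤ A ≤ B + C`), with sharpness witnesses `gate_fails_above`, `gate_fails_below`.

J. Borcea, P. Brändén, *The Lee–Yang and Pólya–Schur programs I*, Invent. Math. 177 (2009), Thms 1.6,
2.2–2.3; Y. Choe, J. Oxley, A. Sokal, D. Wagner, Adv. Appl. Math. 32 (2004) Thm 5.3; theory seat
numerics memo §63–§65 (0 Rayleigh violations on 14 graphs for `Δ ∈ [−0.99,1]`, violations from
`|Δ| = 1.05`).  Nothing here claims A-STAB/B-STAB/T-INT in Lean.
-/

set_option linter.dupNamespace false

noncomputable section

namespace Summit.HubbardSuperconductivity.HubbardSuperconductivity.Theorems.AnisotropyChord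

open Matrix Complex Finset
open Literature.MathematicalPhysics.QuantumLattice Literature.Probability.LatticeModels

variable {V : Type} [Fintype V] [DecidableEq V]

/-- The AMPLITUDE POLYNOMIAL of a state `ψ` on spin-½ configurations `σ : V → Fin 2`:
`a_ψ(z) = Σ_σ ψ(σ) · Π_{x : σ x = 1} z_x` (multi-affine in the site variables `z`; the sites with
`σ x = 1` play the role of occupied sites / up spins — stability does not depend on that convention,
memo §63; theory seat `hubbard-h0-rotor-theory-1`, cycle 6). [folklore] -/
def ampPoly (ψ : TensorIndex V 2 → ℂ) (z : V → ℂ) : ℂ :=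
  ∑ σ : TensorIndex V 2, ψ σ * ∏ x ∈ Finset.univ.filter (fun x => σ x = 1), z x

/-- STABILITY of a function of site variables (for polynomials: no zero in the open upper
poly-half-plane `{Im z_x > 0 ∀ x}`); for a polynomial with real coefficients up to a global phase this is
real stability (Borcea–Brändén). [folklore] -/
def IsStable (p : (V → ℂ) → ℂ) : Prop :=
  ∀ z : V → ℂ, (∀ x, 0 < (z x).im) → p z ≠ 0

omit [Fintype V] [DecidableEq V] in
/-- Stability is invariant under non-zero scalars (so the phase of a ground state is irrelevant). [folklore] -/
theorem isStable_smul_iff (p : (V → ℂ) → ℂ) {c : ℂ} (hc : c ≠ 0) :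
    IsStable (fun z => c * p z) ↔ IsStable p := by
  constructor
  · intro h z hz hp
    exact h z hz (by simp [hp])
  · intro h z hz hcp
    rcases mul_eq_zero.mp hcp with h1 | h1
    · exact hc h1
    · exact h z hz h1


/-- **THEOREM A-STAB (memo ROTOR-THEORY-6 §63; typed statement — proved at paper level, not yet in Lean).**
For EVERY finite connected graph and every anisotropy `Δ ∈ [-1, 1]` (the easy-plane window), every sector
ground state `ψ` of `H(Δ) = xxzHamiltonian 1 G (-1) Δ` has a STABLE amplitude polynomial
`a_ψ(z) = Σ_σ ψ(σ) Π_{σ x = 1} z_x` (no zeros with all `Im z_x > 0`); equivalently the amplitude law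
`|ψ|` is a strong Rayleigh measure.  Proof (paper): the two-site gate `exp(ε h_xy)` acts on multi-affine
polynomials with Borcea–Brändén symbol a 4-variable quadratic whose matrix (a `ℤ₂ × ℤ₂` group matrix with
entries `A = e^{εΔ/4}`, `B = e^{-εΔ/4} cosh(ε/2)`, `C = e^{-εΔ/4} sinh(ε/2)`) has eigenvalues
`A+B+C, A-B-C, -A+B-C, -A-B+C`, at most one of them positive iff `-1 ≤ Δ ≤ 1`; Trotter + Hurwitz +
Perron–Frobenius (`e^{-t(H-E)} e_W → ⟨e_W, ψ⟩ ψ`, `e_W` stable).  No vertex-transitivity needed; fields and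
edge-dependent `J_e > 0`, `Δ_e ∈ [-1,1]` are also covered by the same proof (not typed here).
Numerics: 0 Rayleigh violations on 14 graphs for `Δ ∈ [-0.99, 1]`, violations from `Δ = -1.05`.
[conjecture: theory seat hubbard-h0-rotor-theory-1, cycle 6, 2026-08-27 — proved on paper (memo §63), Lean proof pending the Borcea–Brändén characterisation as Literature facts] -/
def XXZGroundStateAmplitudeStable : Prop :=
  ∀ (V : Type) [Fintype V] [DecidableEq V] (G : SimpleGraph V) [DecidableRel G.Adj],
    G.Connected → ∀ (M Δ : ℝ), -1 ≤ Δ → Δ ≤ 1 →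
      ∀ ψ : TensorIndex V 2 → ℂ, IsSectorGroundState G Δ M ψ → IsStable (ampPoly ψ)

/-- **CONJECTURE B-STAB (memo §63; numerical, all graphs).** On the physical window `Δ ∈ [0, 1]` the BORN
law `|ψ(σ)|²` of every sector ground state is strong Rayleigh: its generating polynomial is stable.  (False
for `Δ < 0` although A-STAB holds there: the Hadamard square of a stable multi-affine polynomial need not be
stable — `C₈`, `W = 3`, `Δ = -0.5` is a counterexample.)  [conjecture: theory seat hubbard-h0-rotor-theory-1, cycle 6, 2026-08-27] -/
def XXZGroundStateBornStable : Prop :=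
  ∀ (V : Type) [Fintype V] [DecidableEq V] (G : SimpleGraph V) [DecidableRel G.Adj],
    G.Connected → ∀ (M Δ : ℝ), 0 ≤ Δ → Δ ≤ 1 →
      ∀ ψ : TensorIndex V 2 → ℂ, IsSectorGroundState G Δ M ψ →
        IsStable (ampPoly (fun σ => ((Complex.normSq (ψ σ) : ℝ) : ℂ)))

/-- The gate eigenvalue computation behind A-STAB, as bare real inequalities:
for `ε > 0`, `A - B - C ≤ 0 ↔ Δ ≤ 1` and `-A + B - C ≤ 0 ↔ -1 ≤ Δ` where
`A = exp(εΔ/4)`, `B ± C = exp(-εΔ/4 ± ε/2)`.  Theory seat, memo §63. [folklore] -/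
theorem gate_signature (ε Δ : ℝ) (hε : 0 < ε) :
    (Real.exp (ε * Δ / 4) ≤ Real.exp (-(ε * Δ / 4) + ε / 2) ↔ Δ ≤ 1) ∧
    (Real.exp (-(ε * Δ / 4) - ε / 2) ≤ Real.exp (ε * Δ / 4) ↔ -1 ≤ Δ) := by
  constructor
  · rw [Real.exp_le_exp]
    constructor
    · intro h; nlinarith
    · intro h; nlinarith
  · rw [Real.exp_le_exp]
    constructor
    · intro h; nlinarith
    · intro h; nlinarith

/-- **The real 2×2 core of the gate preservation (memo §63/§66).**  A real bilinear polynomial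
`a + b z + c w + d z w` is real stable iff `a d ≤ b c`; the XXZ two-site gate acts on its coefficients by
`(a,b,c,d) ↦ (A a, B b + C c, C b + B c, A d)` with `A = e^{εΔ/4}`, `B ± C = e^{-εΔ/4 ± ε/2}`, and it maps the
cone `{a d ≤ b c}` into itself exactly when `B - C ≤ A ≤ B + C`, i.e. `-1 ≤ Δ ≤ 1` (`gate_signature`).
(The full theorem needs polynomial coefficients in the remaining variables — Borcea–Brändén's symbol theorem —
this is its constant-coefficient shadow, with both sharpness witnesses.) Theory seat, memo §63/§66. [folklore] -/
theorem gate_preserves_real_bilinear_cone {A B C a b c d : ℝ} (hC : 0 ≤ C) (hB : C ≤ B)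
    (h1 : B - C ≤ A) (h2 : A ≤ B + C) (hs : a * d ≤ b * c) :
    (A * a) * (A * d) ≤ (B * b + C * c) * (C * b + B * c) := by
  have hA : 0 ≤ A := by linarith
  have hA2 : A ^ 2 * (a * d) ≤ A ^ 2 * (b * c) := mul_le_mul_of_nonneg_left hs (by positivity)
  have hBC : 0 ≤ B * C := mul_nonneg (le_trans hC hB) hC
  -- lower bound A² ≥ (B - C)², upper bound A² ≤ (B + C)²
  have hlo : (B - C) ^ 2 ≤ A ^ 2 := by
    have : 0 ≤ B - C := by linarith
    nlinarith
  have hhi : A ^ 2 ≤ (B + C) ^ 2 := by nlinarith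
  rcases le_or_gt 0 (b * c) with hbc | hbc
  · nlinarith [sq_nonneg (b - c), mul_nonneg hBC (sq_nonneg (b - c))]
  · nlinarith [sq_nonneg (b + c), mul_nonneg hBC (sq_nonneg (b + c))]

/-- The converse direction of sharpness: if `A > B + C` (i.e. `Δ > 1`) the cone is not preserved —
witness `a = d = 1`, `b = c = 1` (`ad = bc`), image has `A² > (B + C)²`. Theory seat, memo §63. [folklore] -/
theorem gate_fails_above {A B C : ℝ} (hC : 0 ≤ C) (hB : C ≤ B) (h : B + C < A) :
    ¬ ((A * 1) * (A * 1) ≤ (B * 1 + C * 1) * (C * 1 + B * 1)) := by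
  intro hle
  have hBC : 0 ≤ B + C := by linarith
  nlinarith

/-- … and if `A < B - C` (i.e. `Δ < -1`): witness `a = 1, d = -1, b = 1, c = -1` (`ad = -1 ≤ bc = -1`),
the image gives `-A² ≤ -(B-C)²`, false when `A < B - C`. Theory seat, memo §63. [folklore] -/
theorem gate_fails_below {A B C : ℝ} (hA : 0 ≤ A) (h : A < B - C) :
    ¬ ((A * 1) * (A * (-1)) ≤ (B * 1 + C * (-1)) * (C * 1 + B * (-1))) := by
  intro hle
  nlinarith

/-- Two functions of the site variables are in PROPER POSITION up to phases (Hermite–Kakeya–Obreschkoff /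
Borcea–Brändén form, orientation- and phase-free): after fixing one non-zero complex scalar for each, every
REAL linear combination is stable or vanishes identically on the upper poly-half-plane. [folklore] -/
def InProperPositionUpToPhase {V : Type} (p q : (V → ℂ) → ℂ) : Prop :=
  ∃ c d : ℂ, c ≠ 0 ∧ d ≠ 0 ∧ ∀ α β : ℝ,
    IsStable (fun z => (α : ℂ) * (c * p z) + (β : ℂ) * (d * q z)) ∨
      ∀ z : V → ℂ, (∀ x, 0 < (z x).im) → (α : ℂ) * (c * p z) + (β : ℂ) * (d * q z) = 0

/-- **THEOREM T-INT (tower interlacing; memo ROTOR-THEORY-6 §65; typed statement, proved at paper level).**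
For every finite connected graph, `Δ ∈ [-1, 1]`, and ADJACENT sectors `M`, `M - 1`, the ground-state
amplitude polynomials `a_W`, `a_{W+1}` are in proper position (`a_{W+1} + y·a_W` is stable in the `|V|+1`
variables `(z, y)` for the positive representatives).  Proof (paper): `P_t = (e^{-tH} ⊗ id_y) Π_v (y + z_v)`
is stable by A-STAB's preserver statement; consecutive `y`-coefficients of a stable polynomial are in proper
position (`∂_y^k`, `y := 0`, multivariate Hermite–Kakeya–Obreschkoff = Borcea–Brändén, Invent. Math. 2009,
Thm 1.6); they are `e^{-tH_{W+1}} e_{W+1}` and `e^{-tH_W} e_W`; proper position is invariant under positive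
rescaling of each and closed under limits; sectorwise power method.  Numerics (g34 'tower'): 0 violations on 8
graphs (VT and not) for `Δ ∈ [-0.99, 1]`; violations at `Δ = -1.2` (C₈ 75, cube 54) and `1.2` (tree7 23).
[conjecture: theory seat hubbard-h0-rotor-theory-1, cycle 6, 2026-08-27 — proved on paper (memo §65), Lean proof pending the Borcea–Brändén facts] -/
def XXZTowerProperPosition : Prop :=
  ∀ (V : Type) [Fintype V] [DecidableEq V] (G : SimpleGraph V) [DecidableRel G.Adj],
    G.Connected → ∀ (M Δ : ℝ), -1 ≤ Δ → Δ ≤ 1 →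
      ∀ ψ φ : TensorIndex V 2 → ℂ, IsSectorGroundState G Δ M ψ → IsSectorGroundState G Δ (M - 1) φ →
        InProperPositionUpToPhase (ampPoly ψ) (ampPoly φ)


end Summit.HubbardSuperconductivity.HubbardSuperconductivity.Theorems.AnisotropyChord
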